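import Literature.MathematicalPhysics.QuantumFieldTheory.Balaban1983to89.T3AvgDivergenceSplit
import Literature.MathematicalPhysics.QuantumFieldTheory.Balaban1983to89.T3PrintedRegularOrbits
import Literature.MathematicalPhysics.QuantumFieldTheory.Balaban1983to89.B11Thm1
import HarnessLib

/-!
# `Balaban1983to89.T3Thm1Carrier` — rung R3, crux K1, child «MinimiserStabilityRegPr» (stmt-QuantumFields-19200): [Balaban1985Variational]
# Theorem 1's LQB carrier `B11.VarProblemX` INSTANTIATED for the variational problem of the T³ family (configurations of run `K`, data of
# run `n`, print's two-clause regular fibre (6) `regFibrePr`, the family's (0.4)-averaging), and the THREE PRINTED SCHEMAS of the item's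
# layer-4 birth — `Thm1MinimalIn8At` (Thm 1 (8)), `MinimisersIn8At` (Prop 8), `MinimiserCurvGradAt` (Thm 1 (9)–(10)) — DERIVED BY NAME from
# LQB's typed statements `B11Thm1.Thm1At` / `B11.Thm1Printed` / `B11.Prop8Printed` at that carrier (d = 3 twin of the T⁴ programme's
# `B11Thm1CarrierT`)

Cell `ym3-torus` (HUMAN RULING D-0037, YM ladder rung R3), seat `ym3-torus-p1` gen 7 (UV side); cell record HOME/UV3-NODE.md §16.  WHAT THIS IS
NOT: nothing of Bałaban's is asserted — `B11Thm1.Thm1At`, `B11.Thm1Printed`, `B11.Prop8Printed` are the LQB lane's hypothesis schemas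
([Balaban1985Variational] typed AS PRINTED over an abstract carrier, with the printed proof architecture Thm 1 ⇐ Prop 7 ∧ Prop 8 ∧ Sect. F
and the induction on `k` kernel-checked over named leaves in `B11`, `B11Thm1`); this file supplies the CONCRETE CARRIER for the d = 3 route
and the one-line edges, so that the K1aR-pr line's printed inputs are literally instances of the LQB statements (and LQB's 250-file apparatus
for [7] becomes citable by the line).  DECLARED READINGS (cell DIVERGENCE style, each weaker than print, flagged):
* R1 «minimal orbit in the space (e)» ↦ `U ∈ regFibrePr(e) ∧ IsMinOn A (regFibrePr e) U` (the GLOBAL-in-(e) reading, as LQB's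
  `B10NestedMinimizer.B11Dict` (ii) and the T⁴ carrier's D-n07a-2);
* R2 «critical configuration of (5) in (6)» (`IsCritical`, used by Prop 8) ↦ «minimises (5) over print's regular fibre at SOME radius `e > 0`»
  (a minimiser over the open space (6)(e) is a critical point of (5) on the constraint manifold; criticality on `SU(2)^{bonds}` is not typed);
  «unique critical orbit in (6)» ↦ every minimiser over (6)(ε₀) lies on the orbit of `U` under print's group (4) (`u↓ = 1`,
  `T3PrintedRegularOrbits.descTransf`) — T⁴ carrier's D-n07a-1;
* R3 (9)–(10) ↦ a GAUGE-INVARIANT POINTWISE READING at the top scale: a «cube» is a point datum `(x, ν, κ, κ′)` of size parameter `M = 1` and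
  scale `j = k = K − n` (`L^jη = 1`); `Gauged := True`, `|A|`, `|∇^ηA|` ↦ `0` (their content at `M = 1` is (8) itself), `‖A‖_{1,β}` ↦ the
  `β₀ = 1` quantity `η⁻³‖(D^{1*}_{U,ν}F_{κκ′})(x)‖` for every `β` (print's `β < 1` clauses are weaker at the top scale and not modelled),
  `max{|∂^{η*}∂^ηA|, |Δ^ηA|}` ↦ `η⁻³‖(D^{1*}_U∂U)_ν(x)‖` (the divergence; the Laplacian is not modelled).  Side condition of the cover:
  `1 ≤ M(ε₁)` (print: `M(ε₁) = R₁M₁a₁/ε₁ ≥ R₁M₁`).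

* §1 `varProblem3 F n K h : B11.VarProblemX`, unfoldings (`Iff.rfl`).
* §2 THE EDGES (PROVED): `thm1MinimalIn8At_of_thm1At` (Thm 1 (8) at the carriers ⇒ `Thm1MinimalIn8At L a₁ B₃`); `minimisersIn8At_of_prop8`
  (`B11.Prop8Printed B₃` over the family of carriers ⇒ `∃ a₅ > 0, ∀ a₁, MinimisersIn8At L a₅ a₁ B₃`); `minimiserCurvGradAt_of_thm1At` (Thm 1's
  regularity clause at the carriers ∧ `MinimisersIn8At` ∧ `1 ≤ M(ε₁)` ⇒ `MinimiserCurvGradAt`); `printedSchemas_of_thm1Printed_prop8` (all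
  three from `B11.Thm1Printed ∧ B11.Prop8Printed` over the family, constants merged).
So after `T3AvgDivergenceSplit`/`T3UpperLiftSplit`: the UV crux child = [7] Thm 1 ∧ Prop 8 AT `varProblem3` (LQB, as printed, readings
R1–R3) + G-K1aR-2 + G-K1a-2′ + G-K1a-3a′ + G-K1a-3b + kernel-checked plumbing.

References: T. Bałaban, CMP 102 (1985) 277–309 [Balaban1985Variational] ((2)–(8) p.278, Thm 1 (8)–(10) p.279, Prop 8 p.304); CMP 99 (1985)
75–102 [Balaban1985RegularSpaces] ((1.1)–(1.2) p.76, (1.9) p.77); CMP 109 (1987) 249–301 [Balaban1987RG1] ((0.4), p.253).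
-/

noncomputable section

open MeasureTheory Filter Topology
open scoped Matrix.Norms.L2Operator
open Literature.MathematicalPhysics.QuantumFieldTheory.Balaban1983to89.T3ContinuumYM3Torus
open Literature.MathematicalPhysics.QuantumFieldTheory.Balaban1983to89.T3UnitLawDensityEML (ℰp measurableE_ℰp)
open Literature.MathematicalPhysics.QuantumFieldTheory.Balaban1983to89.T3UnitScaleTilt
open Literature.MathematicalPhysics.QuantumFieldTheory.Balaban1983to89.T3TiltDescent
open Literature.MathematicalPhysics.QuantumFieldTheory.Balaban1983to89.T3CruxEstimates
open Literature.MathematicalPhysics.QuantumFieldTheory.Balaban1983to89.T3ConstrainedMinimiser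
open Literature.MathematicalPhysics.QuantumFieldTheory.Balaban1983to89.T3DescentFibreTower
open Literature.MathematicalPhysics.QuantumFieldTheory.Balaban1983to89.T3RegularMinimiser
open Literature.MathematicalPhysics.QuantumFieldTheory.Balaban1983to89.T3PrintedRegularMinimiser
open Literature.MathematicalPhysics.QuantumFieldTheory.Balaban1983to89.T3PrintedRegularOrbits (descTransf)
open Literature.MathematicalPhysics.QuantumFieldTheory.Balaban1983to89.T3PrintedMinimiserExistence
open Literature.MathematicalPhysics.QuantumFieldTheory.Balaban1983to89.T3LowerAlongMinimisersSplit
open Literature.MathematicalPhysics.QuantumFieldTheory.Balaban1983to89.T3AvgDivergenceSplit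
open Literature.MathematicalPhysics.QuantumFieldTheory.Balaban1983to89.B10Eq27TorusAxialLog (toUField unitsField)
open Literature.MathematicalPhysics.QuantumFieldTheory.Balaban1983to89.B10Eq68TorusRegularity (plaqFT covDerivT covDivT)
open Literature.MathematicalPhysics.QuantumFieldTheory.Balaban1983to89.B11 (VarProblem VarProblemX Regularity Thm1Printed Prop8Printed)
open Literature.MathematicalPhysics.QuantumFieldTheory.Balaban1983to89.B11Thm1 (Exists8 Unique6 Reg910 Thm1At thm1Printed_iff)
open Literature.MathematicalPhysics.QuantumFieldTheory.Balaban1983to89.Missing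

namespace Literature.MathematicalPhysics.QuantumFieldTheory.Balaban1983to89.T3Thm1Carrier

/-! ## §1 The carrier -/

section Carrier

variable (F : T3Family) (n K : ℕ) (h : n ≤ K)

/-- **PRINT'S GROUP (4) ON THE FIBRE**: `U′` lies on the orbit of `U` under gauge transformations of run `K`'s finest lattice that are trivial on
the comparison lattice (`u↓ = 1`, `T3PrintedRegularOrbits.descTransf`). [cite: Balaban1985Variational, (4) p.278] -/
def SameOrbit (U U' : GaugeField (F.P K) 0 (Matrix.specialUnitaryGroup (Fin 2) ℂ)) : Prop :=
  ∃ u : GaugeTransf (F.P K) 0 (Matrix.specialUnitaryGroup (Fin 2) ℂ), descTransf F n K h u = (fun _ => 1) ∧ U' = GaugeField.gaugeAct u U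

/-- **[Balaban1985Variational] THEOREM 1's CARRIER FOR THE T³ FAMILY** (pure small-field problem of run `K` over the comparison height `n`):
`Cfg` = configurations on the finest lattice of the `K`-th approximation, `Bdry` = data on the finest lattice of the `n`-th; (2) `InU e U :=
RegPr F n K e U` (both clauses); (3) `InB V U := U ∈ fibre V` (the family's (0.4)-descent `D_{n,K}U = V`); (7) `Reg7 ε₁ V := PlaqSmall ε₁ V`;
«minimal orbit in `𝔘(e) ∩ 𝔅(V)`» := reading R1; `IsCritical` / «unique critical orbit in (6)» := reading R2; (9)–(10) := reading R3 (point data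
`(x, ν, κ, κ′)`, `M = 1`, `j = K − n`, `η = L^{−(K−n)}`). [cite: Balaban1985Variational, (2)-(8) p.278 and Thm 1 p.279] -/
def varProblem3 : VarProblemX where
  Cfg := GaugeField (F.P K) 0 (Matrix.specialUnitaryGroup (Fin 2) ℂ)
  Bdry := GaugeField (F.P n) 0 (Matrix.specialUnitaryGroup (Fin 2) ℂ)
  Cube := Site (F.P K) 0 × Fin (F.P K).d × Fin (F.P K).d × Fin (F.P K).d
  scale := fun _ => K - n
  sizeM := fun _ => 1
  eta := ((F.L : ℝ)⁻¹) ^ (K - n)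
  L := F.L
  InU := fun e U => RegPr F n K e U
  InB := fun V U => U ∈ fibre F ℰp n K h V
  Reg7 := fun ε₁ V => PlaqSmall ε₁ V
  OnMinimalOrbit := fun e V U => U ∈ regFibrePr F n K h e V ∧
    IsMinOn (fun W : GaugeField (F.P K) 0 (Matrix.specialUnitaryGroup (Fin 2) ℂ) => wilsonAction4 W) (regFibrePr F n K h e V) U
  UniqueCriticalOrbit := fun ε₀ V U => U ∈ regFibrePr F n K h ε₀ V ∧
    ∀ U' : GaugeField (F.P K) 0 (Matrix.specialUnitaryGroup (Fin 2) ℂ), U' ∈ regFibrePr F n K h ε₀ V →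
      IsMinOn (fun W : GaugeField (F.P K) 0 (Matrix.specialUnitaryGroup (Fin 2) ℂ) => wilsonAction4 W) (regFibrePr F n K h ε₀ V) U' →
        SameOrbit F n K h U U'
  Gauged := fun _ _ => True
  normA := fun _ _ => 0
  normGradA := fun _ _ => 0
  holderA := fun U c _ => if c.2.2.1 ≠ c.2.2.2 then
      ((((F.L : ℝ)⁻¹) ^ (K - n))⁻¹) ^ 3 * ‖covDerivT 1 (unitsField (toUField U)) c.2.1 (plaqFT (unitsField (toUField U)) c.2.2.1 c.2.2.2) c.1‖
    else 0
  normLapA := fun U c => ((((F.L : ℝ)⁻¹) ^ (K - n))⁻¹) ^ 3 * ‖covDivT 1 (unitsField (toUField U)) c.2.1 c.1‖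
  IsCritical := fun V U => ∃ e : ℝ, 0 < e ∧ U ∈ regFibrePr F n K h e V ∧
    IsMinOn (fun W : GaugeField (F.P K) 0 (Matrix.specialUnitaryGroup (Fin 2) ℂ) => wilsonAction4 W) (regFibrePr F n K h e V) U
  SameOrbit := SameOrbit F n K h

variable {F n K h}

/-- (2) at the carrier IS `RegPr` (both clauses). [cite: Balaban1985Variational, (2) p.278] -/
theorem inU_iff (e : ℝ) (U : GaugeField (F.P K) 0 (Matrix.specialUnitaryGroup (Fin 2) ℂ)) :
    (varProblem3 F n K h).InU e U ↔ RegPr F n K e U := Iff.rfl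

/-- (3) at the carrier IS membership in the (0.4)-descent fibre. [cite: Balaban1985Variational, (3) p.278] -/
theorem inB_iff (V : GaugeField (F.P n) 0 (Matrix.specialUnitaryGroup (Fin 2) ℂ)) (U : GaugeField (F.P K) 0 (Matrix.specialUnitaryGroup (Fin 2) ℂ)) :
    (varProblem3 F n K h).InB V U ↔ U ∈ fibre F ℰp n K h V := Iff.rfl

/-- (7) at the carrier IS `PlaqSmall ε₁ V`. [cite: Balaban1985Variational, (7) p.278] -/
theorem reg7_iff (ε₁ : ℝ) (V : GaugeField (F.P n) 0 (Matrix.specialUnitaryGroup (Fin 2) ℂ)) :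
    (varProblem3 F n K h).Reg7 ε₁ V ↔ PlaqSmall ε₁ V := Iff.rfl

/-- «minimal orbit in `𝔘(e) ∩ 𝔅(V)`» at the carrier (reading R1). [cite: Balaban1985Variational, Thm 1 (8) p.279] -/
theorem onMinimalOrbit_iff (e : ℝ) (V : GaugeField (F.P n) 0 (Matrix.specialUnitaryGroup (Fin 2) ℂ))
    (U : GaugeField (F.P K) 0 (Matrix.specialUnitaryGroup (Fin 2) ℂ)) :
    (varProblem3 F n K h).OnMinimalOrbit e V U ↔ U ∈ regFibrePr F n K h e V ∧
      IsMinOn (fun W : GaugeField (F.P K) 0 (Matrix.specialUnitaryGroup (Fin 2) ℂ) => wilsonAction4 W) (regFibrePr F n K h e V) U :=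
  Iff.rfl

/-- **(8) AT THE CARRIER**: `B11Thm1.Exists8` ⇔ a minimiser of the Wilson action over print's regular fibre at radius `B₃ε₁` exists.
[cite: Balaban1985Variational, Thm 1 (8) p.279] -/
theorem exists8_iff (B₃ ε₁ : ℝ) (V : GaugeField (F.P n) 0 (Matrix.specialUnitaryGroup (Fin 2) ℂ)) :
    Exists8 (varProblem3 F n K h).toVarProblem B₃ ε₁ V ↔
      ∃ U ∈ regFibrePr F n K h (B₃ * ε₁) V,
        IsMinOn (fun W : GaugeField (F.P K) 0 (Matrix.specialUnitaryGroup (Fin 2) ℂ) => wilsonAction4 W) (regFibrePr F n K h (B₃ * ε₁) V) U :=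
  ⟨fun ⟨U, _, _, hU⟩ => ⟨U, hU.1, hU.2⟩, fun ⟨U, hU, hmin⟩ => ⟨U, ((mem_regFibrePr_iff F).mp hU).2, hU.1.1, hU, hmin⟩⟩

/-- `L^{K−n}·η = 1` at the carrier (the top scale). [cite: Balaban1985Variational, (2) p.278] -/
theorem scale_mul_eta : (varProblem3 F n K h).L ^ (K - n) * (varProblem3 F n K h).eta = 1 := by
  show (F.L : ℝ) ^ (K - n) * ((F.L : ℝ)⁻¹) ^ (K - n) = 1
  rw [← mul_pow, mul_inv_cancel₀ (L_cast_pos F).ne', one_pow]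

/-- (7) is met by the flat datum: the Theorem-1 slot at the carrier is not vacuous. [cite: Balaban1985Variational, (7) p.278] -/
theorem reg7_one {ε₁ : ℝ} (hε₁ : 0 < ε₁) : (varProblem3 F n K h).Reg7 ε₁ (1 : GaugeField (F.P n) 0 (Matrix.specialUnitaryGroup (Fin 2) ℂ)) :=
  plaqSmall_one hε₁

end Carrier

/-! ## §2 The edges: the three printed schemas of the layer-4 birth from LQB's statements at the carrier -/

section Edges

/-- The index of the family of carriers for one block size `L`: members `F` with `F.L = L`, heights `n < K`. [cite: Balaban1985Variational, Thm 1 p.279 («The constants a₀, a₁, B₃, depend on d and L only»)] -/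
def Idx (L : ℕ) : Type := {p : T3Family × ℕ × ℕ // p.1.L = L ∧ p.2.1 < p.2.2}

/-- The family of carriers over `Idx L` (as `VarProblemX`). [cite: Balaban1985Variational, Thm 1 p.279] -/
def famX (L : ℕ) : Idx L → VarProblemX := fun i => varProblem3 i.1.1 i.1.2.1 i.1.2.2 i.2.2.le

/-- The same family read as `VarProblem`s (Theorem 1's carrier). [cite: Balaban1985Variational, Thm 1 p.279] -/
def fam (L : ℕ) : Idx L → VarProblem := fun i => (famX L i).toVarProblem

/-- **EDGE 1 — `Thm1MinimalIn8At` ⇐ [7] THM 1 (8) AT THE CARRIERS**: Theorem 1 at given constants for every member of the family gives the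
birth's EXIST-schema `Thm1MinimalIn8At L a₁ B₃` (reading R1). [cite: Balaban1985Variational, Thm 1 (8) p.279] -/
theorem thm1MinimalIn8At_of_thm1At {L : ℕ} (C : B11Thm1.Consts) (H : ∀ i : Idx L, Thm1At C (fam L i)) : Thm1MinimalIn8At L C.a₁ C.B₃ := by
  intro F hF n K hnK ε₁ hε₁ hε₁a V hV
  obtain ⟨hex, -, -⟩ := H ⟨(F, n, K), hF, hnK⟩ ε₁ hε₁ hε₁a V hV
  exact (exists8_iff C.B₃ ε₁ V).mp hex

/-- **EDGE 2 — `MinimisersIn8At` ⇐ [7] PROP 8 AT THE CARRIERS** (reading R2): `B11.Prop8Printed B₃` over the family gives `a₅ > 0` with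
`MinimisersIn8At L a₅ a₁ B₃` for every `a₁` (a minimiser over (6)(ε₀) is «critical» in reading R2 with `e = ε₀ > 0`, `ε₀ ≥ B₃ε₁ > 0`).
[cite: Balaban1985Variational, Prop 8 p.304] -/
theorem minimisersIn8At_of_prop8 {L : ℕ} {B₃ : ℝ} (hB₃ : 0 < B₃) (H : Prop8Printed B₃ (famX L)) :
    ∃ a₅ : ℝ, 0 < a₅ ∧ ∀ a₁ : ℝ, MinimisersIn8At L a₅ a₁ B₃ := by
  obtain ⟨a₅, ha₅, H⟩ := H
  refine ⟨a₅, ha₅, fun a₁ F hF n K hnK ε₁ ε₀ hε₁ _ hlo hhi V hV U hU hmin => ?_⟩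
  have hε₀ : 0 < ε₀ := (mul_pos hB₃ hε₁).trans_le hlo
  have hreg : RegPr F n K (B₃ * ε₁) U :=
    H ⟨(F, n, K), hF, hnK⟩ ε₀ ε₁ hε₁ V U hV ((mem_regFibrePr_iff F).mp hU).2 hU.1.1 ⟨ε₀, hε₀, hU, hmin⟩ hhi
  exact (mem_regFibrePr_iff F).mpr ⟨hU.1.1, hreg⟩

/-- **EDGE 3 — `MinimiserCurvGradAt` ⇐ [7] THM 1 (9)–(10) AT THE CARRIERS** (reading R3) ∧ PROP 8: a minimiser over (6)(ε₀) lies in (8)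
(`MinimisersIn8At`), hence on the minimal orbit in (8), and Theorem 1's regularity clause at the point datum `(x, ν, κ, κ′)` (`M = 1 ≤ M(ε₁)`,
`β = 1`) is `η⁻³‖(D^{1*}_{U,ν}F_{κκ′})(x)‖ < B₄ε₁`. [cite: Balaban1985Variational, Thm 1 (9)-(10) p.279 and Prop 8 p.304] -/
theorem minimiserCurvGradAt_of_thm1At {L : ℕ} (C : B11Thm1.Consts) (H : ∀ i : Idx L, Thm1At C (fam L i))
    (hM : ∀ ε₁ : ℝ, 0 < ε₁ → ε₁ ≤ C.a₁ → 1 ≤ C.Mfun ε₁) {a₀ a₁ : ℝ} (h8 : MinimisersIn8At L a₀ a₁ C.B₃) :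
    MinimiserCurvGradAt L a₀ (min a₁ C.a₁) C.B₃ C.B₄ := by
  intro F hF n K hnK ε₁ ε₀ hε₁ hε₁a hlo hhi V hV U hU hmin x ν κ κ' hne
  have hε₁a₁ : ε₁ ≤ a₁ := hε₁a.trans (min_le_left _ _)
  have hε₁C : ε₁ ≤ C.a₁ := hε₁a.trans (min_le_right _ _)
  -- the minimiser lies in (8) and minimises over (8) ⊆ (6)
  have hU8 : U ∈ regFibrePr F n K hnK.le (C.B₃ * ε₁) V := h8 F hF n K hnK ε₁ ε₀ hε₁ hε₁a₁ hlo hhi V hV U hU hmin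
  have hmin8 : IsMinOn (fun W : GaugeField (F.P K) 0 (Matrix.specialUnitaryGroup (Fin 2) ℂ) => wilsonAction4 W)
      (regFibrePr F n K hnK.le (C.B₃ * ε₁) V) U := hmin.on_subset (regFibrePr_mono F hlo V)
  -- Theorem 1's regularity clause at the point datum
  obtain ⟨-, -, hreg⟩ := H ⟨(F, n, K), hF, hnK⟩ ε₁ hε₁ hε₁C V hV
  have hR := hreg U ⟨hU8, hmin8⟩ (x, ν, κ, κ') (hM ε₁ hε₁ hε₁C)
  obtain ⟨-, -, -, hholder, -⟩ := hR
  have h1 := hholder 1 zero_le_one le_rfl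
  -- unfold the carrier's reading of `‖A‖_{1,1}` and the top-scale factor `(L^{K−n}η)⁻¹ = 1`
  have hse : (fam L ⟨(F, n, K), hF, hnK⟩).L ^ (fam L ⟨(F, n, K), hF, hnK⟩).scale (x, ν, κ, κ') *
      (fam L ⟨(F, n, K), hF, hnK⟩).eta = 1 := scale_mul_eta
  rw [hse, inv_one, Real.one_rpow, mul_one] at h1
  change (if κ ≠ κ' then ((((F.L : ℝ)⁻¹) ^ (K - n))⁻¹) ^ 3 *
      ‖covDerivT 1 (unitsField (toUField U)) ν (plaqFT (unitsField (toUField U)) κ κ') x‖ else 0) < C.B₄ * 1 * ε₁ at h1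
  rw [if_pos hne, mul_one] at h1
  -- `η⁻³·‖D‖ < B₄ε₁ ⇒ ‖D‖ < B₄ε₁η³`
  have hη : (0 : ℝ) < ((F.L : ℝ)⁻¹) ^ (K - n) := pow_pos (inv_pos.mpr (L_cast_pos F)) _
  have hη3 : (0 : ℝ) < (((F.L : ℝ)⁻¹) ^ (K - n)) ^ 3 := pow_pos hη 3
  rw [show ((F.L : ℝ)⁻¹) ^ (3 * (K - n)) = (((F.L : ℝ)⁻¹) ^ (K - n)) ^ 3 by rw [← pow_mul, mul_comm]]
  rw [inv_pow, ← div_eq_inv_mul, div_lt_iff₀ hη3] at h1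
  exact h1

/-- **ALL THREE PRINTED SCHEMAS OF THE BIRTH FROM LQB's [7] THM 1 ∧ PROP 8 AT THE CARRIERS**: `B11.Thm1Printed (fam L)` (one block of
constants before the member, `B11Thm1.thm1Printed_iff`) with the cover side condition `1 ≤ M(ε₁)`, and `B11.Prop8Printed B₃ (famX L)` at
Theorem 1's `B₃`, give constants `a₀ a₁ B₃ B₄ > 0`, `B₃a₁ ≤ a₀`, with `Thm1MinimalIn8At L a₁ B₃ ∧ MinimisersIn8At L a₀ a₁ B₃ ∧
MinimiserCurvGradAt L a₀ a₁ B₃ B₄`. [cite: Balaban1985Variational, Thm 1 (8)-(10) p.279 and Prop 8 p.304] -/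
theorem printedSchemas_of_thm1Printed_prop8 {L : ℕ} (C : B11Thm1.Consts) (H : ∀ i : Idx L, Thm1At C (fam L i))
    (hM : ∀ ε₁ : ℝ, 0 < ε₁ → ε₁ ≤ C.a₁ → 1 ≤ C.Mfun ε₁) (H8 : Prop8Printed C.B₃ (famX L)) :
    ∃ a₀ a₁ B₃ B₄ : ℝ, 0 < a₀ ∧ 0 < a₁ ∧ 0 < B₃ ∧ 0 < B₄ ∧ B₃ * a₁ ≤ a₀ ∧
      Thm1MinimalIn8At L a₁ B₃ ∧ MinimisersIn8At L a₀ a₁ B₃ ∧ MinimiserCurvGradAt L a₀ a₁ B₃ B₄ := by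
  obtain ⟨a₅, ha₅, h8⟩ := minimisersIn8At_of_prop8 C.B₃_pos H8
  -- constants: `a₁' := min C.a₁ (a₅/B₃)` keeps the window `B₃a₁' ≤ a₅`
  set a₁' : ℝ := min C.a₁ (a₅ / C.B₃) with ha₁'_def
  have ha₁' : 0 < a₁' := lt_min C.a₁_pos (div_pos ha₅ C.B₃_pos)
  have hwin : C.B₃ * a₁' ≤ a₅ := by
    have := mul_le_mul_of_nonneg_left (min_le_right C.a₁ (a₅ / C.B₃)) C.B₃_pos.le
    rwa [mul_div_cancel₀ _ C.B₃_pos.ne'] at this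
  have h8' : MinimisersIn8At L a₅ a₁' C.B₃ := h8 a₁'
  have hgrad := minimiserCurvGradAt_of_thm1At C H hM h8'
  have hmin_eq : min a₁' C.a₁ = a₁' := min_eq_left (min_le_left _ _)
  rw [hmin_eq] at hgrad
  refine ⟨a₅, a₁', C.B₃, C.B₄, ha₅, ha₁', C.B₃_pos, C.B₄_pos, hwin, ?_, h8', hgrad⟩
  -- `Thm1MinimalIn8At` is antitone in `a₁`
  intro F hF n K hnK ε₁ hε₁ hε₁a V hV
  exact thm1MinimalIn8At_of_thm1At C H F hF n K hnK ε₁ hε₁ (hε₁a.trans (min_le_left _ _)) V hV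

/-- The same from LQB's existentially packaged `B11.Thm1Printed` over the family (constants chosen before the member), provided its `M(·)`
covers unit cubes. [cite: Balaban1985Variational, Thm 1 p.279] -/
theorem printedSchemas_of_thm1Printed_prop8' {L : ℕ}
    (H : ∃ C : B11Thm1.Consts, (∀ i : Idx L, Thm1At C (fam L i)) ∧ (∀ ε₁ : ℝ, 0 < ε₁ → ε₁ ≤ C.a₁ → 1 ≤ C.Mfun ε₁) ∧ Prop8Printed C.B₃ (famX L)) :
    ∃ a₀ a₁ B₃ B₄ : ℝ, 0 < a₀ ∧ 0 < a₁ ∧ 0 < B₃ ∧ 0 < B₄ ∧ B₃ * a₁ ≤ a₀ ∧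
      Thm1MinimalIn8At L a₁ B₃ ∧ MinimisersIn8At L a₀ a₁ B₃ ∧ MinimiserCurvGradAt L a₀ a₁ B₃ B₄ := by
  obtain ⟨C, H, hM, H8⟩ := H
  exact printedSchemas_of_thm1Printed_prop8 C H hM H8

/-- Bookkeeping: `B11.Thm1Printed (fam L)` IS one block of constants with `Thm1At` at every member (`B11Thm1.thm1Printed_iff` by name).
[cite: Balaban1985Variational, Thm 1 p.279] -/
theorem thm1Printed_fam_iff (L : ℕ) : Thm1Printed (fam L) ↔ ∃ C : B11Thm1.Consts, ∀ i : Idx L, Thm1At C (fam L i) :=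
  thm1Printed_iff _

end Edges

end Literature.MathematicalPhysics.QuantumFieldTheory.Balaban1983to89.T3Thm1Carrier

end
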